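import Summits.KontsevichZagierPeriods.Zeta5Search.Certificates.PolyReflectElim2
import HarnessLib

/-!
# ζ(5) search — module reduction in COORDINATE FORM (per-symbol reduction paths, common denominator) (cell `pub-zeta5`, certifier `cert-2`)

HONEST FRAMING: systematic search; recurrence certificates; no irrationality claim unless certified.

The second top-level form of the kernel module-reduction engine (`PolyReflectElim/Shadow/Pack/Elim2`), designed for the
tensor-module certificates (L-K3, L-NK of the ttrl2 lane) where a GLOBAL fraction-free elimination would multiply every
coefficient by every pivot. Here each symbol `X` of the combination `Σ_X C_X·T[X]` is reduced ON ITS OWN: a path `st_X`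
of two-kill steps turns the unit combination `1·T[X]` into `F_X` with `lcEval F_X = D_X · T[X]`,
`D_X = ∏ multipliers(st_X)` (`lcEval_elimRun2`). Multipliers are SIGNED PRODUCTS OF LINEAR FORMS from a factor table
`FT` (`mkMult`), so a common denominator `Z = ∏_{i ∈ Zidx} FT[i]` is reached by multiplying the term of `X` with the
complementary product over `cof_X` — complementarity `cof_X ++ factors(st_X) ~ Zidx` is a PERMUTATION CHECK on index
lists (`List.isPerm`, `decide`). Coefficients are trees `C · ∏ FT[cidx]` that are never expanded: packed values and
shapes are computed structurally (`evZ3_ccoef`, `fits_coef`). Then `G := Σ_X ccoef_X • F_X` has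
`lcEval G = Z · Σ_X C_X T[X]` (`lcEval_coordG`), and `G = 0` is certified as in `PolyReflectPack`: packed evaluation
(`coordGZ`) + shadow (`coordShadow`) + injectivity. Main theorems: `coord_sum_mul_eq_zero`, `coord_sum_eq_zero`.
-/

namespace Summit.KontsevichZagierPeriods.Zeta5Search.PolyReflect

/-! ### Linear-factor tables, signed products, common denominators -/

/-- Value of the linear form `(a,b,c,d) ↦ a·w + b·x + c·k + d`. -/
def linVal (f : ℤ × ℤ × ℤ × ℤ) (w x k : ℚ) : ℚ := f.1 * w + f.2.1 * x + f.2.2.1 * k + f.2.2.2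

/-- The linear form as a `Poly3`. -/
def linPoly (f : ℤ × ℤ × ℤ × ℤ) : Poly3 := lin3 f.1 f.2.1 f.2.2.1 f.2.2.2

/-- `ev3 (linPoly f) = linVal f`. -/
theorem ev3_linPoly (f : ℤ × ℤ × ℤ × ℤ) (w x k : ℚ) : ev3 (linPoly f) w x k = linVal f w x k := by
  obtain ⟨a, b, c, d⟩ := f
  simp [linPoly, linVal, ev3_lin3]

/-- Product of the values of the table factors listed in `idx` (out-of-range index ↦ factor `0`... by `getD` the
zero form `(0,0,0,0)`, value `0`). -/
def fprod (FT : List (ℤ × ℤ × ℤ × ℤ)) (idx : List ℕ) (w x k : ℚ) : ℚ :=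
  (idx.map fun i => linVal (FT.getD i (0, 0, 0, 0)) w x k).prod

/-- The same product as a `Poly3` tree. -/
def mkProd (FT : List (ℤ × ℤ × ℤ × ℤ)) : List ℕ → Poly3
  | [] => cst3 1
  | i :: idx => mul3 (linPoly (FT.getD i (0, 0, 0, 0))) (mkProd FT idx)

/-- `ev3 (mkProd FT idx) = fprod FT idx`. -/
theorem ev3_mkProd (FT : List (ℤ × ℤ × ℤ × ℤ)) (w x k : ℚ) :
    ∀ idx : List ℕ, ev3 (mkProd FT idx) w x k = fprod FT idx w x k
  | [] => by simp [mkProd, fprod, ev3_cst3]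
  | i :: idx => by
    rw [mkProd, ev3_mul3, ev3_linPoly, ev3_mkProd FT w x k idx]; simp [fprod]

/-- `fprod` of a concatenation. -/
theorem fprod_append (FT : List (ℤ × ℤ × ℤ × ℤ)) (w x k : ℚ) (i j : List ℕ) :
    fprod FT (i ++ j) w x k = fprod FT i w x k * fprod FT j w x k := by
  simp [fprod, List.map_append, List.prod_append]

/-- `fprod` is invariant under permutations of the index list. -/
theorem fprod_perm (FT : List (ℤ × ℤ × ℤ × ℤ)) (w x k : ℚ) {i j : List ℕ} (h : i.Perm j) :
    fprod FT i w x k = fprod FT j w x k := by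
  unfold fprod; exact (h.map _).prod_eq

/-- `fprod` is non-zero when every listed factor is. -/
theorem fprod_ne_zero (FT : List (ℤ × ℤ × ℤ × ℤ)) (w x k : ℚ) (idx : List ℕ)
    (h : ∀ i ∈ idx, linVal (FT.getD i (0, 0, 0, 0)) w x k ≠ 0) : fprod FT idx w x k ≠ 0 := by
  unfold fprod
  exact List.prod_ne_zero fun h0 => by
    obtain ⟨i, hi, e⟩ := List.mem_map.1 h0
    exact h i hi e

/-- A signed product of table factors: `σ · ∏_{i ∈ idx} FT[i]` — the shape of every multiplier (pivot). -/
def mkMult (FT : List (ℤ × ℤ × ℤ × ℤ)) (σ : ℤ) (idx : List ℕ) : Poly3 := mul3 (cst3 σ) (mkProd FT idx)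

/-- Value of a signed product. -/
theorem ev3_mkMult (FT : List (ℤ × ℤ × ℤ × ℤ)) (σ : ℤ) (idx : List ℕ) (w x k : ℚ) :
    ev3 (mkMult FT σ idx) w x k = σ * fprod FT idx w x k := by
  rw [mkMult, ev3_mul3, ev3_cst3, ev3_mkProd]

/-- Integer value of a linear form at an integer point. -/
def linValZ (f : ℤ × ℤ × ℤ × ℤ) (w x k : ℤ) : ℤ := f.1 * w + f.2.1 * x + f.2.2.1 * k + f.2.2.2

/-- `evZ3 (linPoly f) = linValZ f`. -/
theorem evZ3_linPoly (f : ℤ × ℤ × ℤ × ℤ) (w x k : ℤ) : evZ3 (linPoly f) w x k = linValZ f w x k := by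
  have h := cast_evZ3 (linPoly f) w x k
  rw [ev3_linPoly] at h
  obtain ⟨a, b, c, d⟩ := f
  simp only [linVal, linValZ] at h ⊢
  exact_mod_cast h

/-- Integer product of table factors. -/
def fprodZ (FT : List (ℤ × ℤ × ℤ × ℤ)) (idx : List ℕ) (w x k : ℤ) : ℤ :=
  (idx.map fun i => linValZ (FT.getD i (0, 0, 0, 0)) w x k).prod

/-- `evZ3 (mkProd FT idx) = fprodZ FT idx`. -/
theorem evZ3_mkProd (FT : List (ℤ × ℤ × ℤ × ℤ)) (w x k : ℤ) :
    ∀ idx : List ℕ, evZ3 (mkProd FT idx) w x k = fprodZ FT idx w x k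
  | [] => by
    have h := cast_evZ3 (cst3 1) w x k
    rw [ev3_cst3] at h
    simp only [mkProd, fprodZ, List.map_nil, List.prod_nil]
    exact_mod_cast h
  | i :: idx => by
    rw [mkProd, evZ3_mul3, evZ3_linPoly, evZ3_mkProd FT w x k idx]; simp [fprodZ]

/-- `evZ3 (cst3 c) = c`. -/
theorem evZ3_cst3 (c : ℤ) (w x k : ℤ) : evZ3 (cst3 c) w x k = c := by
  have h := cast_evZ3 (cst3 c) w x k
  rw [ev3_cst3] at h
  exact_mod_cast h

/-- `evZ3 (mkMult FT σ idx) = σ · fprodZ FT idx`. -/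
theorem evZ3_mkMult (FT : List (ℤ × ℤ × ℤ × ℤ)) (σ : ℤ) (idx : List ℕ) (w x k : ℤ) :
    evZ3 (mkMult FT σ idx) w x k = σ * fprodZ FT idx w x k := by
  rw [mkMult, evZ3_mul3, evZ3_cst3, evZ3_mkProd]

/-- 1-norm of a linear form. -/
def linNorm (f : ℤ × ℤ × ℤ × ℤ) : ℕ := f.1.natAbs + f.2.1.natAbs + f.2.2.1.natAbs + f.2.2.2.natAbs

/-- Shape and norm of `linPoly f`: rows `≤ 2`, blocks `≤ 2`, norm `= linNorm f`. -/
theorem fits_linPoly (f : ℤ × ℤ × ℤ × ℤ) :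
    (∀ b ∈ linPoly f, b.length ≤ 2 ∧ ∀ r ∈ b, r.length ≤ 2) ∧ norm3 (linPoly f) ≤ linNorm f := by
  obtain ⟨a, b, c, d⟩ := f
  refine ⟨?_, ?_⟩
  · intro blk hb
    simp only [linPoly, lin3, List.mem_cons, List.not_mem_nil, or_false] at hb
    rcases hb with rfl | rfl
    · refine ⟨by simp, ?_⟩
      intro r hr
      simp only [List.mem_cons, List.not_mem_nil, or_false] at hr
      rcases hr with rfl | rfl <;> simp
    · refine ⟨by simp, ?_⟩
      intro r hr
      simp only [List.mem_cons, List.not_mem_nil, or_false] at hr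
      subst hr; simp
  · simp [linPoly, lin3, linNorm]; omega

/-- Product of the 1-norms of the listed factors. -/
def fnorm (FT : List (ℤ × ℤ × ℤ × ℤ)) (idx : List ℕ) : ℕ := (idx.map fun i => linNorm (FT.getD i (0, 0, 0, 0))).prod

/-- Shape and norm of `mkProd FT idx`: rows and blocks `≤ |idx| + 1`, norm `≤ fnorm FT idx`. -/
theorem fits_mkProd (FT : List (ℤ × ℤ × ℤ × ℤ)) : ∀ idx : List ℕ,
    (∀ b ∈ mkProd FT idx, b.length ≤ idx.length + 1 ∧ ∀ r ∈ b, r.length ≤ idx.length + 1) ∧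
      norm3 (mkProd FT idx) ≤ fnorm FT idx
  | [] => by
    refine ⟨?_, by simp [mkProd, cst3, fnorm]⟩
    intro b hb
    simp only [mkProd, cst3, List.mem_cons, List.not_mem_nil, or_false] at hb
    subst hb
    refine ⟨by simp, fun r hr => ?_⟩
    simp only [List.mem_cons, List.not_mem_nil, or_false] at hr
    subst hr; simp
  | i :: idx => by
    have ih := fits_mkProd FT idx
    have hl := fits_linPoly (FT.getD i (0, 0, 0, 0))
    refine ⟨?_, ?_⟩
    · have := sh3_mul3 (Wp := 2) (Xp := 2) (Wq := idx.length + 1) (Xq := idx.length + 1) (by omega) (by omega)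
        (by omega) (by omega) _ _ hl.1 ih.1
      rw [mkProd]
      intro b hb
      have hb' := this b hb
      exact ⟨hb'.1.trans (by simp; omega), fun r hr => (hb'.2 r hr).trans (by simp; omega)⟩
    · rw [mkProd]
      exact (norm3_mul3 _ _).trans ((Nat.mul_le_mul hl.2 ih.2).trans (by simp [fnorm]))

/-- Shape and norm of `mkMult FT σ idx`. -/
theorem fits_mkMult (FT : List (ℤ × ℤ × ℤ × ℤ)) (σ : ℤ) (idx : List ℕ) :
    (∀ b ∈ mkMult FT σ idx, b.length ≤ idx.length + 1 ∧ ∀ r ∈ b, r.length ≤ idx.length + 1) ∧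
      norm3 (mkMult FT σ idx) ≤ σ.natAbs * fnorm FT idx := by
  have hp := fits_mkProd FT idx
  have hc : (∀ b ∈ cst3 σ, b.length ≤ 1 ∧ ∀ r ∈ b, r.length ≤ 1) ∧ norm3 (cst3 σ) ≤ σ.natAbs := by
    refine ⟨?_, by simp [cst3]⟩
    intro b hb
    simp only [cst3, List.mem_cons, List.not_mem_nil, or_false] at hb
    subst hb
    refine ⟨by simp, fun r hr => ?_⟩
    simp only [List.mem_cons, List.not_mem_nil, or_false] at hr
    subst hr; simp
  refine ⟨?_, ?_⟩
  · have := sh3_mul3 (Wp := 1) (Xp := 1) (Wq := idx.length + 1) (Xq := idx.length + 1) le_rfl le_rfl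
      (by omega) (by omega) _ _ hc.1 hp.1
    rw [mkMult]
    intro b hb
    have hb' := this b hb
    exact ⟨hb'.1.trans (by omega), fun r hr => (hb'.2 r hr).trans (by omega)⟩
  · rw [mkMult]; exact (norm3_mul3 _ _).trans (Nat.mul_le_mul hc.2 hp.2)

/-- Shape and norm of a coefficient tree `mkMult FT σ idx · C`: rows `≤ maxRow3 C + |idx|`, blocks
`≤ maxBlk3 C + |idx|`, norm `≤ |σ| · fnorm · norm3 C` — computed WITHOUT expanding the product. -/
theorem fits_coef (FT : List (ℤ × ℤ × ℤ × ℤ)) (σ : ℤ) (idx : List ℕ) (C : Poly3) :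
    (∀ b ∈ mul3 (mkMult FT σ idx) C, b.length ≤ max (maxBlk3 C) 1 + idx.length ∧
        ∀ r ∈ b, r.length ≤ max (maxRow3 C) 1 + idx.length) ∧
      norm3 (mul3 (mkMult FT σ idx) C) ≤ σ.natAbs * fnorm FT idx * norm3 C := by
  have hm := fits_mkMult FT σ idx
  have hC := sh3_mono (sh3_measured C) (le_max_left (maxRow3 C) 1) (le_max_left (maxBlk3 C) 1)
  refine ⟨?_, (norm3_mul3 _ _).trans (Nat.mul_le_mul hm.2 le_rfl)⟩
  have := sh3_mul3 (Wp := idx.length + 1) (Xp := idx.length + 1) (Wq := max (maxRow3 C) 1)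
    (Xq := max (maxBlk3 C) 1) (by omega) (by omega) (le_max_right _ _) (le_max_right _ _) _ _ hm.1 hC
  intro b hb
  have hb' := this b hb
  exact ⟨hb'.1.trans (by omega), fun r hr => (hb'.2 r hr).trans (by omega)⟩

/-! ### Coordinate terms -/

/-- A reduction step in factored form: relation indices and killed symbols `(r₁,s₁,r₂,s₂)`, and the multiplier as a
signed product `σ · ∏ FT[idx]`. -/
abbrev FStep := ℕ × ℕ × ℕ × ℕ × ℤ × List ℕ

/-- The concrete run of a factored path. -/
def fpath (FT : List (ℤ × ℤ × ℤ × ℤ)) : List FStep → List (ℕ × ℕ × ℕ × ℕ × Poly3)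
  | [] => []
  | (r₁, s₁, r₂, s₂, σ, idx) :: st => (r₁, s₁, r₂, s₂, mkMult FT σ idx) :: fpath FT st

/-- Sign of a factored path (product of the step signs). -/
def fsign : List FStep → ℤ
  | [] => 1
  | (_, _, _, _, σ, _) :: st => σ * fsign st

/-- All factor indices used by a factored path. -/
def fidx : List FStep → List ℕ
  | [] => []
  | (_, _, _, _, _, idx) :: st => idx ++ fidx st

/-- The product of the multipliers of a factored path is `fsign · fprod (fidx)`. -/
theorem prod_mults2_fpath (FT : List (ℤ × ℤ × ℤ × ℤ)) (w x k : ℚ) :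
    ∀ st : List FStep, ((mults2 (fpath FT st)).map fun p => ev3 p w x k).prod =
      (fsign st : ℚ) * fprod FT (fidx st) w x k
  | [] => by simp [fpath, mults2, fsign, fidx, fprod]
  | (r₁, s₁, r₂, s₂, σ, idx) :: st => by
    rw [fpath, mults2, List.map_cons, List.prod_cons, prod_mults2_fpath FT w x k st, fsign, fidx, fprod_append,
      ev3_mkMult]
    push_cast; ring

/-- A COORDINATE TERM `(C, cidx, X, cof, path)`: the coefficient of symbol `X` is `C · ∏ FT[cidx]` (data times listed
linear factors — never expanded), `cof` is the cofactor index list (so that `cof ++ fidx path ~ Zidx`), and `path` is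
the factored reduction path of `X`. -/
abbrev CTerm := Poly3 × List ℕ × ℕ × List ℕ × List FStep

/-- The coefficient tree of a term inside `G`: `(σ_path · ∏ FT[cof ++ cidx]) · C`. -/
def ccoef (FT : List (ℤ × ℤ × ℤ × ℤ)) (t : CTerm) : Poly3 :=
  mul3 (mkMult FT (fsign t.2.2.2.2) (t.2.2.2.1 ++ t.2.1)) t.1

/-- The combination `G = Σ_X ccoef_X • elimRun2 (path_X) (1·T[X])`. -/
def coordG (FT : List (ℤ × ℤ × ℤ × ℤ)) (rels : List LC) : List CTerm → LC
  | [] => []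
  | (C, cidx, X, cof, st) :: ts =>
    lcAdd (lcSmul (ccoef FT (C, cidx, X, cof, st)) (elimRun2 rels (fpath FT st) (lcSingle X (cst3 1))))
      (coordG FT rels ts)

/-- The target sum `Σ_X (C_X · ∏ FT[cidx_X]) · T[X]`. -/
def ctermSum (T : ℕ → ℚ) (w x k : ℚ) (FT : List (ℤ × ℤ × ℤ × ℤ)) : List CTerm → ℚ
  | [] => 0
  | (C, cidx, X, _, _) :: ts => ev3 C w x k * fprod FT cidx w x k * T X + ctermSum T w x k FT ts

/-- The complementarity / sign checks of the terms against the common-denominator index list `Zidx` (Boolean). -/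
def ctermsOK (Zidx : List ℕ) : List CTerm → Bool
  | [] => true
  | (_, _, _, cof, st) :: ts => (cof ++ fidx st).isPerm Zidx && (fsign st * fsign st == 1) && ctermsOK Zidx ts

/-- **Value of `G`**: `lcEval G = fprod Zidx · Σ_X C_X T[X]` (relations zero, terms complementary to `Zidx`). -/
theorem lcEval_coordG (T : ℕ → ℚ) (w x k : ℚ) (FT : List (ℤ × ℤ × ℤ × ℤ)) (rels : List LC)
    (h : ∀ R ∈ rels, lcEval T w x k 0 R = 0) (Zidx : List ℕ) :
    ∀ ts : List CTerm, ctermsOK Zidx ts = true →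
      lcEval T w x k 0 (coordG FT rels ts) = fprod FT Zidx w x k * ctermSum T w x k FT ts
  | [], _ => by simp [coordG, ctermSum]
  | (C, cidx, X, cof, st) :: ts, hok => by
    simp only [ctermsOK, Bool.and_eq_true, beq_iff_eq] at hok
    obtain ⟨⟨hperm, hsq⟩, hts⟩ := hok
    have hp : fprod FT (cof ++ fidx st) w x k = fprod FT Zidx w x k := fprod_perm FT w x k (List.isPerm_iff.1 hperm)
    rw [fprod_append] at hp
    have hsq' : ((fsign st : ℤ) : ℚ) * (fsign st : ℚ) = 1 := by exact_mod_cast hsq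
    rw [coordG, lcEval_lcAdd, lcEval_lcSmul, lcEval_elimRun2 T w x k rels h, lcEval_lcSingle, prod_mults2_fpath,
      ccoef, ev3_mul3, ev3_mkMult, fprod_append, ev3_cst3, lcEval_coordG T w x k FT rels h Zidx ts hts, ctermSum,
      ← hp, zero_add]
    push_cast
    linear_combination (fprod FT cof w x k * fprod FT (fidx st) w x k * ev3 C w x k * fprod FT cidx w x k * T X) *
      hsq'

/-! ### Packed `G` and its shadow -/

/-- Packed `G` (big integers; the multipliers and coefficients are packed on the fly). -/
def coordGZ (w x k : ℤ) (FT : List (ℤ × ℤ × ℤ × ℤ)) (rels : List (List ℤ)) : List CTerm → List ℤ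
  | [] => []
  | (C, cidx, X, cof, st) :: ts =>
    zAdd (zSmul (fsign st * fprodZ FT (cof ++ cidx) w x k * evZ3 C w x k)
      (elimRun2Z w x k rels (fpath FT st) (packLC w x k (lcSingle X (cst3 1))))) (coordGZ w x k FT rels ts)

/-- Packed value of a coefficient tree (no expansion of the product). -/
theorem evZ3_ccoef (w x k : ℤ) (FT : List (ℤ × ℤ × ℤ × ℤ)) (t : CTerm) :
    evZ3 (ccoef FT t) w x k = fsign t.2.2.2.2 * fprodZ FT (t.2.2.2.1 ++ t.2.1) w x k * evZ3 t.1 w x k := by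
  rw [ccoef, evZ3_mul3, evZ3_mkMult]

/-- Packing commutes with `coordG`. -/
theorem packLC_coordG (w x k : ℤ) (FT : List (ℤ × ℤ × ℤ × ℤ)) (rels : List LC) :
    ∀ ts : List CTerm, packLC w x k (coordG FT rels ts) = coordGZ w x k FT (rels.map (packLC w x k)) ts
  | [] => rfl
  | (C, cidx, X, cof, st) :: ts => by
    rw [coordG, coordGZ, packLC_lcAdd, packLC_lcSmul, evZ3_ccoef, packLC_elimRun2, packLC_coordG w x k FT rels ts]

/-- Shadow of `G`: bounds `(W, X, H)` for all entries, from measured shapes of the coefficients and the path shadows. -/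
def coordShadow (FT : List (ℤ × ℤ × ℤ × ℤ)) (rels : List LC) : List CTerm → ℕ × ℕ × ℕ
  | [] => (1, 1, 0)
  | (C, cidx, X, cof, st) :: ts =>
    let idx := cof ++ cidx
    let Wc := max (maxRow3 C) 1 + idx.length
    let Xc := max (maxBlk3 C) 1 + idx.length
    let Hc := (fsign st).natAbs * fnorm FT idx * norm3 C
    let S := elimShadow2 rels (fpath FT st) (lcMeasure (lcSingle X (cst3 1)))
    let R := coordShadow FT rels ts
    (max (Wc + S.1 - 1) R.1, max (Xc + S.2.1 - 1) R.2.1, Hc * S.2.2 + R.2.2)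

/-- Monotonicity of "fits". -/
theorem lcFits_mono {W X H W' X' H' : ℕ} (E : LC) (hW : W ≤ W') (hX : X ≤ X') (hH : H ≤ H')
    (h : ∀ c ∈ E, (∀ b ∈ c, b.length ≤ X ∧ ∀ r ∈ b, r.length ≤ W) ∧ norm3 c ≤ H) :
    ∀ c ∈ E, (∀ b ∈ c, b.length ≤ X' ∧ ∀ r ∈ b, r.length ≤ W') ∧ norm3 c ≤ H' :=
  fun c hc => ⟨sh3_mono (h c hc).1 hW hX, (h c hc).2.trans hH⟩

/-- The bounds of `coordShadow` are `≥ 1` in the shape components. -/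
theorem one_le_coordShadow (FT : List (ℤ × ℤ × ℤ × ℤ)) (rels : List LC) :
    ∀ ts : List CTerm, 1 ≤ (coordShadow FT rels ts).1 ∧ 1 ≤ (coordShadow FT rels ts).2.1
  | [] => by simp [coordShadow]
  | (C, cidx, X, cof, st) :: ts => by
    have := one_le_coordShadow FT rels ts
    simp only [coordShadow]
    exact ⟨this.1.trans (le_max_right _ _), this.2.trans (le_max_right _ _)⟩

/-- **Soundness of the shadow of `G`.** -/
theorem lcFits_coordG (FT : List (ℤ × ℤ × ℤ × ℤ)) (rels : List LC) :
    ∀ ts : List CTerm, ∀ c ∈ coordG FT rels ts,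
      (∀ b ∈ c, b.length ≤ (coordShadow FT rels ts).2.1 ∧ ∀ r ∈ b, r.length ≤ (coordShadow FT rels ts).1) ∧
        norm3 c ≤ (coordShadow FT rels ts).2.2
  | [] => by simp [coordG]
  | (C, cidx, X, cof, st) :: ts => by
    have hrest := lcFits_coordG FT rels ts
    have hcf := fits_coef FT (fsign st) (cof ++ cidx) C
    have hmE := one_le_lcMeasure (lcSingle X (cst3 1))
    have hE := lcFits_measure (lcSingle X (cst3 1))
    have hrun := lcFits_elimRun2 rels (fpath FT st) (lcSingle X (cst3 1)) _ _ _ hmE.1 hmE.2.1 hE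
    have hS1 := one_le_elimShadow2 rels (fpath FT st) _ _ (lcMeasure (lcSingle X (cst3 1))).2.2 hmE.1 hmE.2.1
    have hsm := lcFits_smul (Wa := max (maxRow3 C) 1 + (cof ++ cidx).length)
      (Xa := max (maxBlk3 C) 1 + (cof ++ cidx).length) ⟨by omega, by omega⟩ hS1 _ hcf.1 hcf.2 _ hrun
    intro d hd
    simp only [coordG, ccoef] at hd
    simp only [coordShadow]
    have hadd := lcFits_add
      (W := max (max (maxRow3 C) 1 + (cof ++ cidx).length +
        (elimShadow2 rels (fpath FT st) (lcMeasure (lcSingle X (cst3 1)))).1 - 1) (coordShadow FT rels ts).1)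
      (X := max (max (maxBlk3 C) 1 + (cof ++ cidx).length +
        (elimShadow2 rels (fpath FT st) (lcMeasure (lcSingle X (cst3 1)))).2.1 - 1) (coordShadow FT rels ts).2.1)
      _ _ (lcFits_mono _ (le_max_left _ _) (le_max_left _ _) le_rfl hsm)
      (lcFits_mono _ (le_max_right _ _) (le_max_right _ _) le_rfl hrest)
    exact hadd d hd

/-- The Boolean side conditions of the packed coordinate check. -/
def coordFits (FT : List (ℤ × ℤ × ℤ × ℤ)) (rels : List LC) (ts : List CTerm) (β D₁ D₂ : ℕ) : Bool :=
  let S := coordShadow FT rels ts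
  decide (1 ≤ D₁ ∧ 1 ≤ D₂ ∧ S.1 ≤ D₁ ∧ S.2.1 ≤ D₂ ∧ S.2.2 < β)

/-- **Coordinate-form module reduction, packed.** If every relation evaluates to `0`, the terms are complementary to
`Zidx` (`ctermsOK`, by `decide`), the shadow fits `(β, D₁, D₂)` (`coordFits`, by `decide`) and the kernel finds the
packed `G` to vanish (`zIsZero (coordGZ …)`, by `decide` — big-integer arithmetic), then
`fprod Zidx · Σ_X C_X·T[X] = 0`. -/
theorem coord_sum_mul_eq_zero (T : ℕ → ℚ) (w x k : ℚ) (FT : List (ℤ × ℤ × ℤ × ℤ)) (rels : List LC) (Zidx : List ℕ)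
    (ts : List CTerm) (β D₁ D₂ : ℕ) (h : ∀ R ∈ rels, lcEval T w x k 0 R = 0) (hok : ctermsOK Zidx ts = true)
    (hfit : coordFits FT rels ts β D₁ D₂ = true)
    (hz : zIsZero (coordGZ β ((β : ℤ) ^ D₁) ((β : ℤ) ^ (D₁ * D₂)) FT
      (rels.map (packLC β ((β : ℤ) ^ D₁) ((β : ℤ) ^ (D₁ * D₂)))) ts) = true) :
    fprod FT Zidx w x k * ctermSum T w x k FT ts = 0 := by
  simp only [coordFits, decide_eq_true_eq] at hfit
  obtain ⟨hD₁, hD₂, hW, hX, hH⟩ := hfit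
  have hfits := lcFits_coordG FT rels ts
  rw [← packLC_coordG] at hz
  have hzero := eq_zero_of_zIsZero _ hz
  have hall : ∀ c ∈ coordG FT rels ts, ev3 c w x k = 0 := by
    intro c hc
    have hc' := hfits c hc
    refine ev3_eq_zero_of_evZ3_eq_zero c β D₁ D₂ hD₁ hD₂ (lt_of_le_of_lt hc'.2 hH)
      (fun b hb => ⟨(hc'.1 b hb).1.trans hX, fun r hr => ((hc'.1 b hb).2 r hr).trans hW⟩) ?_ w x k
    exact hzero _ (List.mem_map.2 ⟨c, hc, rfl⟩)
  rw [← lcEval_coordG T w x k FT rels h Zidx ts hok]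
  exact lcEval_eq_zero_of_forall T w x k _ 0 hall

/-- **Coordinate-form module reduction** — the form used by the certificate files: as `coord_sum_mul_eq_zero`, plus
the non-vanishing of the common-denominator factors, concluding `Σ_X C_X · T[X] = 0`. -/
theorem coord_sum_eq_zero (T : ℕ → ℚ) (w x k : ℚ) (FT : List (ℤ × ℤ × ℤ × ℤ)) (rels : List LC) (Zidx : List ℕ)
    (ts : List CTerm) (β D₁ D₂ : ℕ) (h : ∀ R ∈ rels, lcEval T w x k 0 R = 0)
    (hZ : ∀ i ∈ Zidx, linVal (FT.getD i (0, 0, 0, 0)) w x k ≠ 0) (hok : ctermsOK Zidx ts = true)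
    (hfit : coordFits FT rels ts β D₁ D₂ = true)
    (hz : zIsZero (coordGZ β ((β : ℤ) ^ D₁) ((β : ℤ) ^ (D₁ * D₂)) FT
      (rels.map (packLC β ((β : ℤ) ^ D₁) ((β : ℤ) ^ (D₁ * D₂)))) ts) = true) :
    ctermSum T w x k FT ts = 0 :=
  (mul_eq_zero.1 (coord_sum_mul_eq_zero T w x k FT rels Zidx ts β D₁ D₂ h hok hfit hz)).resolve_left
    (fprod_ne_zero FT w x k Zidx hZ)

end Summit.KontsevichZagierPeriods.Zeta5Search.PolyReflect
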